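import Literature.Combinatorics.Designs.BaseSequences

/-!
# Sum-of-squares conditions for complementary sequences (T-sequences, base sequences, Turyn-type sequences)

The first necessary condition ("grammar") of every search for complementary sequences: if the autocorrelations of a
family of sequences sum to zero off the origin, the squares of the row sums add up to the total weight.
[Seberry–Yamada, *Hadamard Matrices* (Wiley 2020)] (`SeberryYamada2020`) Lemma 1.19: for `(0, ±1)` sequences
`X₁, …, X_m` of length `n` with `N_X = 0` or `P_X = 0`, weights `xᵢ` and element sums `aᵢ`, `Σ aᵢ² = Σ xᵢ` (proof:
`Yᵢ J = aᵢ J` for the circulants `Yᵢ`, and `Σ Yᵢ Yᵢᵀ J = Σ aᵢ² J`).  Instances stated in the literature we formalise: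
* T-sequences of length `n`: `t₁² + t₂² + t₃² + t₄² = n` (SY 2020 Definition 1.59 (iv)) — `tseq_sum_sq`;
* base sequences `BS(m, m, n, n)`: `a² + b² + c² + d² = 2(m + n)` (the "sums of squares" column of SY 2020 Table 5.4;
  [Best–Đoković–Kharaghani–Ramp 2013] (`BestDjokovicKharaghaniRamp2013`) §5, `N(A)+N(B)+N(C)+N(D) = 2(m+n)` at `x = 1`)
  — `baseSeq_sum_sq`;
* Turyn-type sequences `TT(n)`: `x² + y² + 2z² + 2w² = 6n - 2` (BDKR 2013 §1, eq. (1) `N(A)+N(B)+2N(C)+2N(D) = 6n-2`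
  at `x = 1`) — `turynType_sum_sq`.
At the census parameters: `TT(56)`: `x² + y² + 2z² + 2w² = 334`; `BS(84, 84, 83, 83)`: `a² + b² + c² + d² = 334`;
T-sequences of length `167`: `Σ tₖ² = 167`.

The engine is the periodic identity `(Σᵢ uᵢ)² = Σ_s P_u(s)` on `ZMod L` (`sq_sum_eq_sum_paf`, the computation of SY 2020
Lemma 1.19) combined with `P = N(s) + N(L - s)` (`TSequences.paf_periodize`, SY 2020 Lemma 1.21), giving the
aperiodic form `(Σ_{i<L} xᵢ)² = N_x(0) + Σ_{s ≠ 0} (N_x(s) + N_x(L - s))` (`sq_sum_eq_npaf`).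
Cell pub-namedobj (venture DiscreteObjects), target H.  No `sorry`, no new axioms.
-/

open Finset BigOperators

namespace Literature.Combinatorics.Designs.SequenceSums

open Literature.Combinatorics.Designs.LegendrePairs (PAF)
open Literature.Combinatorics.Designs.TSequences
open Literature.Combinatorics.Designs.BaseSequences

/-! ## §1 The periodic identity and its aperiodic form -/

section Periodic

variable {L : ℕ} [NeZero L]

/-- `(Σᵢ uᵢ)² = Σ_s P_u(s)` for a sequence on `ZMod L` (`Y J = a J` and `Y Yᵀ J = a² J` for the circulant `Y`).
[cite: SeberryYamada2020, Lemma 1.19 (proof)] -/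
theorem sq_sum_eq_sum_paf (u : ZMod L → ℤ) : (∑ i, u i) ^ 2 = ∑ s, PAF u s := by
  rw [sq, Fintype.sum_mul_sum]
  unfold PAF
  conv_rhs => rw [Finset.sum_comm]
  refine Finset.sum_congr rfl fun i _ => ?_
  exact (Fintype.sum_equiv (Equiv.addLeft i) (fun s => u i * u (i + s)) (fun j => u i * u j) fun _ => rfl).symm

/-- a sum over `ZMod L` of a function of `i.val` is the sum over `range L`. [folklore] -/
private lemma sum_zmod_val (g : ZMod L → ℤ) (f : ℕ → ℤ) (h : ∀ i, g i = f i.val) :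
    ∑ i, g i = ∑ j ∈ range L, f j := by
  refine Finset.sum_nbij' (fun i : ZMod L => i.val) (fun j : ℕ => (j : ZMod L)) ?_ ?_ ?_ ?_ ?_
  · intro a _
    exact mem_range.mpr (ZMod.val_lt a)
  · intro j _
    exact mem_univ _
  · intro a _
    exact ZMod.natCast_zmod_val a
  · intro j hj
    exact ZMod.val_cast_of_lt (mem_range.mp hj)
  · intro a _
    exact h a

/-- **aperiodic form**: `(Σ_{i<L} xᵢ)² = N_x(0) + Σ_{s ≠ 0} (N_x(s) + N_x(L - s))`, the sum over the non-zero
`s : ZMod L`. [cite: SeberryYamada2020, Lemma 1.19 (proof) with Lemma 1.21] -/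
theorem sq_sum_eq_npaf (x : ℕ → ℤ) :
    (∑ i ∈ range L, x i) ^ 2 =
      NPAF L x 0 + ∑ s ∈ (univ : Finset (ZMod L)).erase 0, (NPAF L x s.val + NPAF L x (L - s.val)) := by
  rw [← sum_zmod_val (periodize L x) x (fun _ => rfl), sq_sum_eq_sum_paf]
  simp only [paf_periodize]
  rw [← Finset.add_sum_erase _ _ (mem_univ (0 : ZMod L)), ZMod.val_zero, Nat.sub_zero, npaf_of_le x le_rfl, add_zero]

end Periodic

/-- `N_x(0) = L` for a `±1` sequence of length `L`. [cite: SeberryYamada2020, Lemma 1.19 (weight of a (1,-1) sequence)] -/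
theorem npaf_zero_of_pm {L : ℕ} {x : ℕ → ℤ} (hx : PMOn L x) : NPAF L x 0 = L := by
  unfold NPAF
  rw [Nat.sub_zero]
  calc ∑ i ∈ range L, x i * x (i + 0) = ∑ i ∈ range L, (1 : ℤ) := by
        refine sum_congr rfl fun i hi => ?_
        rw [add_zero]
        rcases hx i (mem_range.mp hi) with h | h <;> simp [h]
    _ = L := by simp

/-! ## §2 T-sequences: `t₁² + t₂² + t₃² + t₄² = n` -/

/-- in each position of T-sequences the squares of the four entries add up to `1`. [cite: SeberryYamada2020, Definition 1.60] -/
lemma tseq_sum_sq_entry {n : ℕ} {t : Fin 4 → ℕ → ℤ} (ht : IsTSeq n t) {i : ℕ} (hi : i < n) :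
    ∑ k, t k i * t k i = 1 := by
  obtain ⟨k, hk, h0⟩ := ht.1 i hi
  rw [Finset.sum_eq_single k]
  · rcases hk with h | h <;> simp [h]
  · intro k' _ hk'
    simp [h0 k' hk']
  · intro h
    exact absurd (mem_univ k) h

/-- **T-sequences of length `n` have `t₁² + t₂² + t₃² + t₄² = n`** (`tₖ` the element sums; the total weight is `n`).
[cite: SeberryYamada2020, Definition 1.59 (iv) with Lemma 1.19] -/
theorem tseq_sum_sq {n : ℕ} {t : Fin 4 → ℕ → ℤ} (ht : IsTSeq n t) :
    ∑ k, (∑ i ∈ range n, t k i) ^ 2 = n := by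
  rcases Nat.eq_zero_or_pos n with rfl | hn
  · simp
  · haveI : NeZero n := ⟨hn.ne'⟩
    simp_rw [sq_sum_eq_npaf (L := n)]
    rw [Finset.sum_add_distrib, Finset.sum_comm]
    have hz : ∑ s ∈ (univ : Finset (ZMod n)).erase 0, ∑ k, (NPAF n (t k) s.val + NPAF n (t k) (n - s.val)) = 0 := by
      refine Finset.sum_eq_zero fun s hs => ?_
      have hs0 : s ≠ 0 := (mem_erase.mp hs).1
      have hv : s.val ≠ 0 := fun h => hs0 ((ZMod.val_eq_zero s).mp h)
      have hv' : n - s.val ≠ 0 := by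
        have := ZMod.val_lt s
        omega
      rw [Finset.sum_add_distrib, ht.npaf hv, ht.npaf hv', add_zero]
    rw [hz, add_zero]
    -- the weights: Σ_k N_{t_k}(0) = Σ_i Σ_k t_k(i)² = n
    unfold NPAF
    rw [Nat.sub_zero, Finset.sum_comm]
    calc ∑ i ∈ range n, ∑ k, t k i * t k (i + 0) = ∑ i ∈ range n, (1 : ℤ) := by
          refine sum_congr rfl fun i hi => ?_
          simp_rw [add_zero]
          exact tseq_sum_sq_entry ht (mem_range.mp hi)
      _ = n := by simp

/-! ## §3 Base sequences: `a² + b² + c² + d² = 2(m + n)` -/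

/-- right zero-padding to any length `L ≥ m` does not change the autocorrelation.
[cite: SeberryYamada2020, §1.10 (padding remark after (1.15))] -/
lemma npaf_padRight_le {m L : ℕ} (h : m ≤ L) (x : ℕ → ℤ) (s : ℕ) :
    NPAF L (cat m x fun _ => 0) s = NPAF m x s := by
  obtain ⟨k, rfl⟩ := Nat.exists_eq_add_of_le h
  exact npaf_padRight m k x s

/-- the row sum of the padded sequence is the row sum. [cite: SeberryYamada2020, §1.10 (padding remark after (1.15))] -/
lemma sum_padRight_le {m L : ℕ} (h : m ≤ L) (x : ℕ → ℤ) :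
    ∑ i ∈ range L, cat m x (fun _ => 0) i = ∑ i ∈ range m, x i := by
  obtain ⟨k, rfl⟩ := Nat.exists_eq_add_of_le h
  rw [← Finset.sum_range_add_sum_Ico _ (Nat.le_add_right m k)]
  have h1 : ∑ i ∈ range m, cat m x (fun _ => (0 : ℤ)) i = ∑ i ∈ range m, x i :=
    sum_congr rfl fun i hi => if_pos (mem_range.mp hi)
  have h2 : ∑ i ∈ Ico m (m + k), cat m x (fun _ => (0 : ℤ)) i = 0 :=
    sum_eq_zero fun i hi => if_neg (by rw [mem_Ico] at hi; omega)
  rw [h1, h2, add_zero]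

/-- **base sequences `BS(m, m, n, n)` have `a² + b² + c² + d² = 2(m + n)`** (`a, b, c, d` the element sums).
[cite: BestDjokovicKharaghaniRamp2013, §5 (N(A)+N(B)+N(C)+N(D) = 2(m+n), at x = 1)] -/
theorem baseSeq_sum_sq {m n : ℕ} {a b c d : ℕ → ℤ} (h : IsBaseSeq m n a b c d) :
    (∑ i ∈ range m, a i) ^ 2 + (∑ i ∈ range m, b i) ^ 2 + (∑ i ∈ range n, c i) ^ 2 + (∑ i ∈ range n, d i) ^ 2
      = 2 * (m + n) := by
  obtain ⟨ha, hb, hc, hd, hN⟩ := h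
  rcases Nat.eq_zero_or_pos (m + n) with hmn | hmn
  · have hm : m = 0 := by omega
    have hn : n = 0 := by omega
    subst hm; subst hn; simp
  · haveI : NeZero (m + n) := ⟨hmn.ne'⟩
    -- pad the four sequences to the common length L = m + n
    have hmL : m ≤ m + n := Nat.le_add_right m n
    have hnL : n ≤ m + n := Nat.le_add_left n m
    rw [← sum_padRight_le hmL a, ← sum_padRight_le hmL b, ← sum_padRight_le hnL c, ← sum_padRight_le hnL d,
      sq_sum_eq_npaf (L := m + n), sq_sum_eq_npaf (L := m + n), sq_sum_eq_npaf (L := m + n),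
      sq_sum_eq_npaf (L := m + n)]
    simp only [npaf_padRight_le hmL, npaf_padRight_le hnL]
    have hz : ∑ s ∈ (univ : Finset (ZMod (m + n))).erase 0,
        ((NPAF m a s.val + NPAF m a (m + n - s.val)) + (NPAF m b s.val + NPAF m b (m + n - s.val)) +
          (NPAF n c s.val + NPAF n c (m + n - s.val)) + (NPAF n d s.val + NPAF n d (m + n - s.val))) = 0 := by
      refine Finset.sum_eq_zero fun s hs => ?_
      have hs0 : s ≠ 0 := (mem_erase.mp hs).1
      have hv : s.val ≠ 0 := fun e => hs0 ((ZMod.val_eq_zero s).mp e)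
      have hlt : s.val < m + n := ZMod.val_lt s
      have h1 := hN s.val hlt hv
      have h2 := hN (m + n - s.val) (by omega) (by omega)
      linarith
    rw [Finset.sum_add_distrib, Finset.sum_add_distrib, Finset.sum_add_distrib] at hz
    rw [npaf_zero_of_pm ha, npaf_zero_of_pm hb, npaf_zero_of_pm hc, npaf_zero_of_pm hd]
    linarith

/-! ## §4 Turyn-type sequences: `x² + y² + 2z² + 2w² = 6n - 2` -/

/-- **Turyn-type sequences `TT(n)` have `x² + y² + 2z² + 2w² = 6n - 2`** (`x, y, z, w` the element sums; `n ≥ 1`).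
[cite: BestDjokovicKharaghaniRamp2013, §1 (eq. (1): N(A)+N(B)+2N(C)+2N(D) = 6n-2, at x = 1)] -/
theorem turynType_sum_sq {n : ℕ} {x y z w : ℕ → ℤ} (h : IsTurynType n x y z w) (hn : 1 ≤ n) :
    (∑ i ∈ range n, x i) ^ 2 + (∑ i ∈ range n, y i) ^ 2 + 2 * (∑ i ∈ range n, z i) ^ 2 +
        2 * (∑ i ∈ range (n - 1), w i) ^ 2 = 6 * n - 2 := by
  obtain ⟨m, rfl⟩ : ∃ m, n = m + 1 := ⟨n - 1, by omega⟩
  obtain ⟨hx, hy, hz, hw, hN⟩ := h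
  simp only [Nat.add_sub_cancel] at hw hN ⊢
  have hmL : m ≤ m + 1 := Nat.le_succ m
  rw [← sum_padRight_le hmL w, sq_sum_eq_npaf (L := m + 1), sq_sum_eq_npaf (L := m + 1), sq_sum_eq_npaf (L := m + 1),
    sq_sum_eq_npaf (L := m + 1)]
  simp only [npaf_padRight_le hmL]
  have hzs : ∑ s ∈ (univ : Finset (ZMod (m + 1))).erase 0,
      ((NPAF (m + 1) x s.val + NPAF (m + 1) x (m + 1 - s.val)) + (NPAF (m + 1) y s.val + NPAF (m + 1) y (m + 1 - s.val)) +
        2 * (NPAF (m + 1) z s.val + NPAF (m + 1) z (m + 1 - s.val)) + 2 * (NPAF m w s.val + NPAF m w (m + 1 - s.val))) = 0 := by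
    refine Finset.sum_eq_zero fun s hs => ?_
    have hs0 : s ≠ 0 := (mem_erase.mp hs).1
    have hv : s.val ≠ 0 := fun e => hs0 ((ZMod.val_eq_zero s).mp e)
    have hlt : s.val < m + 1 := ZMod.val_lt s
    have h1 := hN s.val hlt hv
    have h2 := hN (m + 1 - s.val) (by omega) (by omega)
    linarith
  rw [Finset.sum_add_distrib, Finset.sum_add_distrib, Finset.sum_add_distrib, ← Finset.mul_sum, ← Finset.mul_sum] at hzs
  rw [npaf_zero_of_pm hx, npaf_zero_of_pm hy, npaf_zero_of_pm hz, npaf_zero_of_pm hw]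
  push_cast
  linarith

end Literature.Combinatorics.Designs.SequenceSums
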